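import Summits.HodgeConjecture.HodgeConjecture.Theorems.K2E3KeysThmTwoDepthZeroBranchBInertLeaf        -- ★ p862384 (this seat, (W-2)): `exists_eta_of_reducible_of_shellLetters` — :155 at an inert place ⟸ the two shell values `H1`, `H0`
import Summits.HodgeConjecture.HodgeConjecture.Theorems.K2E3BranchBShellOneInert                      -- ★ p862374 (K2E3-p06 (g5)): (II)-a letter (c) `integral_Sh_one` — the shell-one value at an inert place `v ∤ 2`
import HarnessLib

/-!
# K2 ∕ E3 «EllipticInputs», unit U4 «Keys» — (U4f-χ₁-ram-one-d0B) THE SOCKET :155 AT AN INERT PLACE `v ∤ 2`, MODULO EXACTLY THE SHELL-ZERO VALUE `∫_{Sh 0} F₀`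
# `i(χ₁, 1)` reducible (χ₁ continuous, non-unitary, contracting, depth zero, Branch B; `v` non-split, unramified in `L`, `v ∤ 2`) ⟹ `χ₁ = η · ‖·‖^{1∕2}`
# [Keys1984 §3–§4, §7 Thm (2); Casselman1980 §3; Casselman1995 §6.4, Thm. 6.6.2; Rogawski1990 §12.1–§12.2; Roche1998 §3–§4]

Cell `pub/hodgecm-mathlib` (D-0151), crux H413 = `stmt-HodgeConjecture-24833`, route of record `HCCMUnconditional`; chair K2-lead (g2), LINE-LEAD∕dealer K2E3-plan (g5) (L4 DEALS ROUND 3,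
2026-09-04T22:08Z (4): «R90-C10-p04 (W-1)∕(W-2) closing wrapper «=»»), cell «U4-RAM» (Z3-c frame v1, K2E3-p03 (g9)).  Typed by the S1 hand R90-C10-p04 (g0).  THEOREMS ONLY (no `def`, no
`instance`, no notation, no named-fact hypothesis, no `sorry`); lane `--supports stmt-HodgeConjecture-24833 --as helper`, count-neutral.  NOT THE PAYER: the shell-ZERO value `H0`
((II)-b3 `K2E3BranchBShellZero.integral_Sh_zero`, K2E3-p03 (g9), unfiled at typing time) remains the ONE hypothesis, ∀-closed over the frame letters `(w) (δ₀) (hδσ) (hδv)` and over every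
Borel σ-algebra ∕ Haar measure of `N(L⁺_v)`, in EXACTLY the binder shape `h0` of ★ `…BranchBInert.exists_eta_of_reducible_of_shellIdentities` with `ε₀ := ((χ₁ δ₀ : ℂˣ) : ℂ)`.

THE POINT.  ★ (W-2) `exists_eta_of_reducible_of_shellLetters` (this seat) reduced :155 at an inert place to the two shell values `H1` (shell one) and `H0` (shell zero); ★ p862374
`K2E3BranchBShellOneInert.integral_Sh_one` (K2E3-p06 (g5)) IS `H1` at `v ∤ 2`, in the agreed binder bytes.  This module plugs it in — the interface between the cell's letter (c) and the
wrapper is thereby kernel-checked — and leaves :155 at an inert odd place modulo `H0` ALONE.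
* **`exists_eta_of_reducible_of_shellZero`** — :155's second disjunct at an inert place `v ∤ 2` from `H0` alone.
THE PAYER (when ★ `integral_Sh_zero` lands, letters `(L v w hw hunr h2w … χ₁ h₁ hdepth hB hram δ₀ hδσ hδv μ)` per frame v1):
`exists_eta_of_reducible_of_shellZero L v hns hunr h2 χ₁ h₁ hnu hcontr hdepth hB (fun w δ₀ hδσ hδv _ _ μ _ => integral_Sh_zero L v w (hns w) hunr (h2 w) … μ … hram δ₀ hδσ hδv) hred`.
HONEST LABEL.  HC_CM is proved only modulo the 7 printed citations (2 remaining named inputs: hLiu418 = `stmt-HodgeConjecture-24832`, h413 = `stmt-HodgeConjecture-24833`) until rung 0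
closes; count-neutral — this file does NOT pay the leaf; no printed citation is discharged.

## References
* [Keys1984] D. Keys, *Principal series representations of special unitary groups over local fields*, Compositio Math. 51 (1984), §3–§4, §7 Theorem (2) p. 126.
* [Casselman1980] W. Casselman, *The unramified principal series of p-adic groups I*, Compositio Math. 40 (1980), §3.
* [Casselman1995] W. Casselman, *Introduction to the theory of admissible representations of `p`-adic reductive groups* (1995), §6.4, Thm. 6.6.2.
* [Rogawski1990] J. Rogawski, *Automorphic representations of unitary groups in three variables*, Ann. of Math. Stud. 123 (1990), §12.1 p. 171, §12.2 (1)–(2) p. 173.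
* [Roche1998] A. Roche, *Types and Hecke algebras for principal series representations of split reductive p-adic groups*, Ann. Sci. ÉNS (4) 31 (1998), §3–§4.
-/

set_option autoImplicit false
-- the mandated namespace has the single-problem summit's repeated segment (`HodgeConjecture.HodgeConjecture`)
set_option linter.dupNamespace false

noncomputable section

open NumberField IsDedekindDomain MeasureTheory
open scoped Matrix MatrixGroups WithZero Valued NNReal
open Literature.NumberTheory Literature.NumberTheory.Automorphic Literature.NumberTheory.Automorphic.UnitaryGroup
open Literature.NumberTheory.Rogawski1990

namespace Summit.HodgeConjecture.HodgeConjecture.Cruxes.H413.K2E3KeysThmTwoDepthZeroBranchBInertOdd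

open Summit.HodgeConjecture.HodgeConjecture.Cruxes.H413

variable (L : Type) [Field L] [NumberField L] [IsCMField L] (v : HeightOneSpectrum (𝓞 ↥(maximalRealSubfield L)))

/-! ## :155 at an inert place `v ∤ 2`, modulo the shell-zero value -/

open Classical in
set_option maxHeartbeats 4000000 in
set_option synthInstance.maxHeartbeats 400000 in
-- ★ (W-2) with `H1 :=` ★ `K2E3BranchBShellOneInert.integral_Sh_one`
/-- **THE SOCKET :155 AT AN INERT PLACE `v ∤ 2`, MODULO THE SHELL-ZERO VALUE.**  `v` non-split, UNRAMIFIED in `L`, `|2|_w = 1` at every `w ∣ v`; `χ₁ : (L ⊗ L⁺_v)ˣ → ℂˣ` continuous,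
non-unitary, contracting, trivial on the principal units (depth zero), `χ₁(u·σu) = 1` on the units of valuation one (Branch B).  HYPOTHESIS `H0` (the shell-zero value of PAPER-Z3 §1, for
EVERY `w ∣ v`, EVERY skew unit `δ₀` with `|(δ₀)_w| = 1`, EVERY Borel σ-algebra and Haar measure `μ` of `N(L⁺_v)`, on the frame-v1 integrand `F₀`): `∫_{|z|_w = 1} F₀ dμ = −(χ₁(δ₀)·((q−1)∕q²)·μ{|z|_w ≤ 1})`.
If `i(χ₁, 1)` is reducible then **`χ₁ = η · ‖·‖^{1∕2}` for a continuous quadratic character extension `η`**.  Proof: ★ (W-2) `exists_eta_of_reducible_of_shellLetters` with the shell-one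
value `H1 :=` ★ `integral_Sh_one` (K2E3-p06 (g5); `∫_{|z|_w = exp 1} F₀ dμ = χ₁(δ₀)·Y·((q−1)∕q²)·μ{|z|_w ≤ 1}`, inert `v ∤ 2`).
[cite: Keys1984, §3–§4, §7 Theorem (2) p. 126] [cite: Casselman1980, §3] [cite: Casselman1995, §6.4, Thm. 6.6.2] [cite: Rogawski1990, §12.2 (1)–(2) p. 173] [cite: Roche1998, §3–§4] -/
theorem exists_eta_of_reducible_of_shellZero
    (hns : ∀ w' : PlacesOver L v, IsCMField.complexConj L • w'.1 = w'.1) (hunr : Algebra.IsUnramifiedIn (𝓞 L) v.asIdeal)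
    (h2 : ∀ w' : PlacesOver L v, Valued.v (2 : w'.1.adicCompletion L) = 1)
    (χ₁ : (LocalRing L v)ˣ →* ℂˣ) (h₁ : Continuous fun x => ((χ₁ x : ℂˣ) : ℂ)) (hnu : ∃ x, ‖((χ₁ x : ℂˣ) : ℂ)‖ ≠ 1)
    (hcontr : ∀ x : (LocalRing L v)ˣ, unitModulusChar (LocalRing L v) x < 1 → ‖((χ₁ x : ℂˣ) : ℂ)‖ < 1)
    (hdepth : ∀ u : (LocalRing L v)ˣ, (∀ w' : PlacesOver L v, Valued.v (((u : LocalRing L v) w') - 1) < 1) → χ₁ u = 1)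
    (hB : ∀ u : (LocalRing L v)ˣ, (∀ w' : PlacesOver L v, Valued.v ((u : LocalRing L v) w') = 1) →
      χ₁ (u * Units.map (conjLocal L (IsCMField.complexConj L) v : LocalRing L v →* LocalRing L v) u) = 1)
    (H0 : ∀ (w : PlacesOver L v) (δ₀ : (LocalRing L v)ˣ), conjLocal L (IsCMField.complexConj L) v (δ₀ : LocalRing L v) = -(δ₀ : LocalRing L v) →
      Valued.v ((δ₀ : LocalRing L v) w) = 1 →
      ∀ [MeasurableSpace ↥(cmBorelTriple L 3 v).N] [BorelSpace ↥(cmBorelTriple L 3 v).N] (μ : Measure ↥(cmBorelTriple L 3 v).N) [μ.IsHaarMeasure],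
      ∫ n in {m : ↥(cmBorelTriple L 3 v).N | Valued.v (((((m : ↥(unitaryGroupOfForm (conjLocal L (IsCMField.complexConj L) v) (cmLocalForm L 3 v))) : GL (Fin 3) (LocalRing L v)) : Matrix (Fin 3) (Fin 3) (LocalRing L v)) 0 2) w) = 1}, (fun n : ↥(cmBorelTriple L 3 v).N =>
        if h : IsUnit ((((n : ↥(unitaryGroupOfForm (conjLocal L (IsCMField.complexConj L) v) (cmLocalForm L 3 v))) : GL (Fin 3) (LocalRing L v)) : Matrix (Fin 3) (Fin 3) (LocalRing L v)) 0 2) then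
          ((((χ₁ (Units.map ((conjLocal L (IsCMField.complexConj L) v) : LocalRing L v →* LocalRing L v) h.unit))⁻¹ : ℂˣ) : ℂ) *
            ((((unitModulusChar (LocalRing L v) h.unit)⁻¹ : ℝ≥0) : ℝ) : ℂ))
        else 0) n ∂μ = -(((χ₁ δ₀ : ℂˣ) : ℂ) * ((((Ideal.absNorm v.asIdeal : ℝ) : ℂ) - 1) / ((Ideal.absNorm v.asIdeal : ℝ) : ℂ) ^ 2) * ((μ.real {m : ↥(cmBorelTriple L 3 v).N | Valued.v (((((m : ↥(unitaryGroupOfForm (conjLocal L (IsCMField.complexConj L) v) (cmLocalForm L 3 v))) : GL (Fin 3) (LocalRing L v)) : Matrix (Fin 3) (Fin 3) (LocalRing L v)) 0 2) w) ≤ 1} : ℝ) : ℂ)))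
    (hred : ∃ N : Subrepresentation (cmPrincipalSeries L 3 v (cmTorusCharPair L v χ₁ 1)), N ≠ ⊥ ∧ N ≠ ⊤) :
    ∃ η : (LocalRing L v)ˣ →* ℂˣ, IsQuadraticCharExtension (conjLocal L (IsCMField.complexConj L) v) η ∧
      Continuous (fun x => ((η x : ℂˣ) : ℂ)) ∧ χ₁ = η * halfModulusChar (LocalRing L v) :=
  K2E3KeysThmTwoDepthZeroBranchBInertLeaf.exists_eta_of_reducible_of_shellLetters L v hns hunr χ₁ h₁ hnu hcontr hdepth hB
    (fun w δ₀ hδσ hδv _ _ μ _ => K2E3BranchBShellOneInert.integral_Sh_one L v w (hns w) hunr (h2 w) χ₁ hdepth hB δ₀ hδσ hδv μ)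
    H0 hred

end Summit.HodgeConjecture.HodgeConjecture.Cruxes.H413.K2E3KeysThmTwoDepthZeroBranchBInertOdd

end
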